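import Summits.QuantumFields.YangMills.Theorems.IR.MomentumPincerNoLightMoversSC

/-!
# Strong-coupling floor engine, part 16: torus clustering with the POLYNOMIAL strong-coupling rate `(β/r)^{‖x‖ − c}`

Pooled prover `ym-ir-line-bsf-p1` (crux `IR`, stmt-QuantumFields-19354), support for the consumer rung R2 of line
`momentum-pincer` (`NoLightMoversSCTransfer`).  R1's `MomentumPincerRung.torusClustering_uniform_fixedRate` weakens
the Osterwalder–Seiler bound `K (β/r)^{‖x‖ − c}` to the β-independent `K e^{c} e^{−‖x‖}`; the slice sums of R2 need the
β-dependence kept (the far off-diagonal terms of `s(1) = Σ_{x⃗} Cov(P_{(0,x⃗)}, P_{(1,0⃗)})` must be `O(β⁵)`).  This file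
re-runs the same proof (tree `PlaqSystem.norm_truncatedExpect_le` on far displacements, `_le_const` on near ones) and
records the polynomial form: ONE constant `C(F₁,F₂)` and one offset `c(F₁,F₂)` with
`|⟨F₁ (F₂∘θ_x)⟩ − ⟨F₁⟩⟨F₂∘θ_x⟩| ≤ C (β/r)^{‖x‖_∞ − c}` on every torus of side `L + 1 > 2‖x‖` and every `0 ≤ β ≤ r`,
`r = betaOne d ρ / 2` (`torusClustering_uniform_poly`).  HONEST: strong coupling only; nothing here bears on the
Yang–Mills mass gap.
-/

set_option autoImplicit false

namespace Summit.QuantumFields.YangMills.Cruxes.IR.SCFloor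

open MeasureTheory Finset Filter Topology
open Literature.MathematicalPhysics.QuantumFieldTheory
open Literature.MathematicalPhysics.QuantumLattice (configShift configShift_apply toTorusObservable
  IsCylinder IsLocalObservable LGConfig)
open Literature.Probability.LatticeModels (Torus.proj Torus.proj_apply)
open Literature.Probability.LatticeModels.Site (supNorm supNorm_le_iff natAbs_le_supNorm
  exists_natAbs_eq_supNorm norm_eq_supNorm)

noncomputable section

variable {d N : ℕ} {G : Type} [Group G] [TopologicalSpace G] [IsTopologicalGroup G]
  [CompactSpace G] [MeasurableSpace G] [BorelSpace G] (ρ : G →* Matrix (Fin N) (Fin N) ℂ)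

/-- **Osterwalder–Seiler torus clustering with the polynomial strong-coupling rate**, uniform in the volume, the
displacement and the coupling: with `r = betaOne d ρ / 2`, for local bounded measurable `F₁, F₂` there are `c ∈ ℕ` and
`C ≥ 0` with `|⟨F₁ (F₂∘θ_x)⟩ − ⟨F₁⟩⟨F₂∘θ_x⟩| ≤ C (β/r)^{‖x‖_∞ − c}` (truncated subtraction in the exponent) on every
torus of side `L + 1 > 2‖x‖` and for every `0 ≤ β ≤ r`. -/
theorem torusClustering_uniform_poly (hd : 2 ≤ d) (hρ : Continuous ρ) :
    ∃ r : ℝ, 0 < r ∧ ∀ F₁ F₂ : LGConfig d G → ℝ,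
      Literature.MathematicalPhysics.QuantumLattice.IsLocalObservable F₁ →
      Literature.MathematicalPhysics.QuantumLattice.IsLocalObservable F₂ →
      Measurable F₁ → Measurable F₂ → (∃ C, ∀ U, |F₁ U| ≤ C) → (∃ C, ∀ U, |F₂ U| ≤ C) →
        ∃ (c : ℕ) (C : ℝ), 0 ≤ C ∧ ∀ β : ℝ, 0 ≤ β → β ≤ r →
          ∀ (L : ℕ) (x : Literature.Probability.LatticeModels.Site d), 2 * ‖x‖ < (L : ℝ) + 1 →
            |wilsonExpectation (L := L + 1) ρ β
                  (toTorusObservable (L + 1) fun U => F₁ U * F₂ (configShift x U)) -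
                wilsonExpectation (L := L + 1) ρ β (toTorusObservable (L + 1) F₁) *
                  wilsonExpectation (L := L + 1) ρ β
                    (toTorusObservable (L + 1) (F₂ ∘ configShift x))| ≤
              C * (β / r) ^ (supNorm x - c) := by
  classical
  haveI : NeZero d := ⟨by omega⟩
  set r : ℝ := betaOne d ρ / 2 with hrdef
  have hr : 0 < r := by have := betaOne_pos d (ρ := ρ); positivity
  have hrR : r < betaOne d ρ := by have := betaOne_pos d (ρ := ρ); rw [hrdef]; linarith
  refine ⟨r, hr, fun F₁ F₂ hloc₁ hloc₂ h₁m h₂m hb₁ hb₂ => ?_⟩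
  obtain ⟨B₁, hB₁⟩ := hloc₁
  obtain ⟨S₂, hS₂⟩ := hloc₂
  obtain ⟨C₁, hC₁⟩ := hb₁
  obtain ⟨C₂, hC₂⟩ := hb₂
  have hC₁0 : 0 ≤ C₁ := (abs_nonneg _).trans (hC₁ fun _ => 1)
  have hC₂0 : 0 ≤ C₂ := (abs_nonneg _).trans (hC₂ fun _ => 1)
  set c : ℕ := bondRadius B₁ + bondRadius S₂ + 2 with hcdef
  set sB : ℕ := (B₁.card + S₂.card) * (2 ^ d * (d * d)) with hsB
  set κ : ℝ := 2 * Real.exp (1 / 2) with hκ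
  have hκ1 : 1 ≤ κ := by
    rw [hκ]; have := Real.one_lt_exp_iff.2 (by norm_num : (0 : ℝ) < 1 / 2); linarith
  set Kunif : ℝ := C₁ * C₂ * κ ^ sB + C₁ * κ ^ sB * (C₂ * κ ^ sB) with hKunif
  have hKunif0 : 0 ≤ Kunif := by positivity
  refine ⟨c, Kunif, hKunif0, fun β hβ0 hβr L x hx => ?_⟩
  set L' : ℕ := L + 1 with hL'
  have hR : (torusSystem (d := d) (G := G) ρ L').Regular (costBound ρ) (Plaq.degBound d) :=
    torusSystem_regular ρ hρ
  set X₀ : ℕ := supNorm x with hX₀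
  have hxn : ‖x‖ = (X₀ : ℝ) := norm_eq_supNorm x
  have hx' : 2 * X₀ < L' := by
    have h : (2 : ℝ) * X₀ < (L : ℝ) + 1 := by rwa [hxn] at hx
    exact_mod_cast h
  set Φ₁ : ZdGaugeConfig d G → ℂ := fun U => (F₁ (U ∘ torusRed L') : ℂ) with hΦ₁
  set Φ₂ : ZdGaugeConfig d G → ℂ := fun U => (F₂ (configShift x (U ∘ torusRed L')) : ℂ) with hΦ₂
  set B₂ : Finset (ZdEdge d) := S₂.image fun e => (e.1 - x, e.2) with hB₂
  have hΦ₁m : Measurable Φ₁ :=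
    Complex.measurable_ofReal.comp (h₁m.comp (measurable_comp_relabel (torusRed L')))
  have hΦ₂m : Measurable Φ₂ :=
    Complex.measurable_ofReal.comp ((h₂m.comp (configShift x).measurable).comp
      (measurable_comp_relabel (torusRed L')))
  have hΦ₁b : ∀ U, ‖Φ₁ U‖ ≤ C₁ := fun U => by
    rw [hΦ₁, Complex.norm_real, Real.norm_eq_abs]; exact hC₁ _
  have hΦ₂b : ∀ U, ‖Φ₂ U‖ ≤ C₂ := fun U => by
    rw [hΦ₂, Complex.norm_real, Real.norm_eq_abs]; exact hC₂ _
  have hΦ₁d : DependsOn Φ₁ ((B₁.image (torusRed L') : Finset (ZdEdge d)) : Set (ZdEdge d)) :=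
    dependsOn_comp_torusRed L' (F := fun U => (F₁ U : ℂ)) fun U V h => by
      show (F₁ U : ℂ) = F₁ V; rw [hB₁ h]
  have hΦ₂d : DependsOn Φ₂ ((B₂.image (torusRed L') : Finset (ZdEdge d)) : Set (ZdEdge d)) := by
    have h := IsCylinder.comp_configShift hS₂ x
    exact dependsOn_comp_torusRed L' (F := fun U => ((F₂ ∘ configShift x) U : ℂ)) fun U V h' => by
      show (((F₂ ∘ configShift x) U : ℝ) : ℂ) = ((F₂ ∘ configShift x) V : ℝ); rw [h h']
  refine (abs_truncated_le_norm_expect ρ hρ β L' h₁m h₂m hC₁ hC₂ x).trans ?_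
  change ‖(torusSystem ρ L').expect (fun U => Φ₁ U * Φ₂ U) (torusGenuine d L') β -
      (torusSystem ρ L').expect Φ₁ (torusGenuine d L') β *
        (torusSystem ρ L').expect Φ₂ (torusGenuine d L') β‖ ≤ Kunif * (β / r) ^ (X₀ - c)
  have hs₁ : ((torusSystem (G := G) ρ L').seedsOf (B₁.image (torusRed L'))).card ≤ sB := by
    refine (card_seedsOf_torusSystem_le ρ B₁).trans ((card_seedsOf_le_mul B₁).trans ?_)
    rw [hsB]; exact Nat.mul_le_mul_right _ (Nat.le_add_right _ _)
  have hB₂c : B₂.card ≤ S₂.card := Finset.card_image_le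
  have hs₂ : ((torusSystem (G := G) ρ L').seedsOf (B₂.image (torusRed L'))).card ≤ sB := by
    refine (card_seedsOf_torusSystem_le ρ B₂).trans ((card_seedsOf_le_mul B₂).trans ?_)
    rw [hsB]; exact Nat.mul_le_mul_right _ (hB₂c.trans (Nat.le_add_left _ _))
  have hs₁₂ : ((torusSystem (G := G) ρ L').seedsOf
      (B₁.image (torusRed L') ∪ B₂.image (torusRed L'))).card ≤ sB := by
    rw [← Finset.image_union]
    refine (card_seedsOf_torusSystem_le ρ _).trans ((card_seedsOf_le_mul _).trans ?_)
    rw [hsB]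
    exact Nat.mul_le_mul_right _ ((Finset.card_union_le _ _).trans (Nat.add_le_add_left hB₂c _))
  have hK : C₁ * C₂ * κ ^ ((torusSystem (G := G) ρ L').seedsOf
        (B₁.image (torusRed L') ∪ B₂.image (torusRed L'))).card +
      C₁ * κ ^ ((torusSystem (G := G) ρ L').seedsOf (B₁.image (torusRed L'))).card *
        (C₂ * κ ^ ((torusSystem (G := G) ρ L').seedsOf (B₂.image (torusRed L'))).card) ≤ Kunif := by
    rw [hKunif]
    refine add_le_add (mul_le_mul_of_nonneg_left (pow_le_pow_right₀ hκ1 hs₁₂) (by positivity))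
      (mul_le_mul (mul_le_mul_of_nonneg_left (pow_le_pow_right₀ hκ1 hs₁) hC₁0)
        (mul_le_mul_of_nonneg_left (pow_le_pow_right₀ hκ1 hs₂) hC₂0) (by positivity)
        (by positivity))
  have hβn : ‖(β : ℂ)‖ ≤ r := by
    rw [Complex.norm_real, Real.norm_eq_abs, abs_of_nonneg hβ0]; exact hβr
  have hβR : ‖(β : ℂ)‖ ≤ PlaqSystem.betaR (costBound ρ) (Plaq.degBound d) := by
    rw [betaR_costBound]; exact hβn.trans hrR.le
  have hq0 : 0 ≤ β / r := div_nonneg hβ0 hr.le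
  have hq1 : β / r ≤ 1 := (div_le_one hr).2 hβr
  by_cases hfar : c < X₀
  · -- far displacements: disjoint supports, long joining polymers
    have hdisj : Disjoint (B₁.image (torusRed L')) (B₂.image (torusRed L')) :=
      disjoint_image_torusRed (by rw [hcdef] at hfar; omega) hx'
    have hn : ∀ Q, Q ⊆ torusGenuine d L' →
        (torusSystem (G := G) ρ L').Joins Q (B₁.image (torusRed L')) (B₂.image (torusRed L')) →
        X₀ - c ≤ Q.card := by
      intro Q _ hJ
      have h := PlaqSystem.le_card_of_joins (S := torusSystem (G := G) ρ L')
        (fun p => tdist L' originPlaq p)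
        (fun u v huv => tdist_le_of_tadj originPlaq ((torusSystem_adj_iff ρ).1 huv))
        (a := bondRadius B₁ + 1) (b := X₀ - bondRadius S₂ - 1)
        (fun p hp => by
          obtain ⟨y, rfl, hy⟩ := (touches_torusSystem_iff ρ B₁ p).1 hp
          exact tdist_le_of_touches hy)
        (fun q hq => by
          obtain ⟨y, rfl, hy⟩ := (touches_torusSystem_iff ρ B₂ q).1 hq
          exact le_tdist_of_touches_shift hy hx') hJ
      rw [hcdef]; omega
    have hbound := PlaqSystem.norm_truncatedExpect_le hR hΦ₁m hΦ₂m hΦ₁b hΦ₂b hΦ₁d hΦ₂d hdisj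
      (torusGenuine d L') hn hr (by rwa [betaR_costBound]) hβn
    refine hbound.trans ?_
    rw [Complex.norm_real, Real.norm_eq_abs, abs_of_nonneg hβ0]
    exact mul_le_mul_of_nonneg_right hK (pow_nonneg hq0 _)
  · -- near displacements: the crude bound, exponent `0`
    push Not at hfar
    have hbound := PlaqSystem.norm_truncatedExpect_le_const hR hβR hΦ₁m hΦ₂m hΦ₁b hΦ₂b hΦ₁d hΦ₂d
      (torusGenuine d L')
    refine (hbound.trans hK).trans ?_
    rw [Nat.sub_eq_zero_of_le hfar, pow_zero, mul_one]

end

end Summit.QuantumFields.YangMills.Cruxes.IR.SCFloor
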